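import Literature.Geometry.Riemannian.MetricFlowFDistanceExtendAux2
import Literature.Geometry.Riemannian.MetricFlowSliceCloseness
import Literature.Geometry.Riemannian.MetricFlowSliceMassDistribution
import Literature.Geometry.Riemannian.MetricFlowTimeContinuity
import HarnessLib

/-!
# Extending `𝔽`-distance estimates to larger time domains — the comparison spaces `Z_t`
# (Bamler 2023, §7.2, Lemma 7.? (arXiv v1 Lemma 160), construction of `Z_t ⊇ Z_{t'}`)

R. Bamler, *Compactness theory of the space of super Ricci flows*, Invent. Math. 233 (2023), §7.2,
proof of Lemma 7.? (arXiv v1 Lemma 160): *"by Propositions (mass distribution), (closeness of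
nearby time-slices) for `i = 1, 2` there are metric spaces `(Z̃^i, d^{Z̃^i})` and isometric
embeddings `φ̃^i_t : 𝒳^i_t → Z̃^i`, `φ̃^i_{t'} : 𝒳^i_{t'} → Z̃^i` such that
`∫_{𝒳^i_{t'}}∫_{𝒳^i_t} d^{Z̃^i}(φ̃^i_t(x), φ̃^i_{t'}(x')) dν^i_{x';t}(x) dμ^i_{t'}(x') ≤ Ψ(δ)`. Using Lemma
2.? (combining embeddings), we can combine the spaces `Z̃¹`, `Z_{t'}`, `Z̃²` and assume that the
isometric embeddings `φ̃¹_t`, `φ̃¹_{t'} = φ¹_{t'}`, `φ²_{t'} = φ̃²_{t'}`, `φ²_t` map into a single space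
`Z_t ⊃ Z_{t'}`."*

This auxiliary file provides, over the tree's §4.1/§4.2 files (`measure_thinSet_slice_le`,
`goodSet`, `edist_le_wassersteinW1_add_of_mem_goodSet`, `CrossMetricSum`, `sliceCost_hyp`,
`lintegral_lintegral_edist_inl_inr_le_ofReal`):

* `MetricFlow.sliceUnionBound H V η` — the explicit `Ψ` of (4.8),
  `√(Hη) + 3η + 2(√η(√(V + Hη) + √V) + 3η²)`;
* `MetricFlow.IsHConcentrated.exists_crossMetricSum_lintegral_le` — **the space `Z̃ = 𝒳_s ⊔ 𝒳_t`
  with `∫∫ d_{Z̃}(φ_s x, φ_t y) dν_{y;s}(x) dμ_t(y) ≤ Ψ`**, its quantitative hypotheses (the scale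
  `ζ`, the future time `t + τ` feeding the mass-distribution Proposition, `t − s ≤ δ`, the average
  distance condition `∫∫ d_t dμ_t dμ_t ≤ ∫∫ d_s dμ_s dμ_s + δ`, `Var ≤ V`) spelled out;
* `DoubleGlue`, `doubleGlue` — **Lemma 2.? (combining isometric embeddings) for the chain
  `Z̃¹ ⊇ 𝒳¹_{t'} ⊆ Z_{t'} ⊇ 𝒳²_{t'} ⊆ Z̃²`** (two `Metric.GlueSpace` steps);
* `MetricFlowPair.ExtensionData` (the data of `Z_t` with its four embeddings and the two bounds),
  `ExtensionData.base` (`t ∈ I₀`: `Z_t` itself), `ExtensionData.ofSliceUnion`,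
  `ExtensionData.ofExists` (`t ∉ I₀`: the glued space), and `MetricFlowPair.extCorrespondence` —
  **the extended correspondence `ℭ₁` over `I₁`** assembled from such data, with
  `kernelDistWithin_extCorrespondence` (its integrand, by `rfl`).

Everything is proved; no named facts.

## References

* R. H. Bamler, *Compactness theory of the space of super Ricci flows*, Invent. Math. 233 (2023),
  1121–1277 (arXiv:2008.09298), §7.2, Lemma 7.? (arXiv v1 Lemma 160), proof; §2.4, Lemma
  (combining isometric embeddings); §4.1, Proposition; §4.2, Proposition, (4.8). [Bamler2023]
-/

noncomputable section

open Set MeasureTheory ProbabilityTheory Filter TopologicalSpace Function Metric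
open scoped Topology ENNReal NNReal ProbabilityTheory

namespace Literature.Geometry.Riemannian

universe u

/-! ### The space `Z̃ = 𝒳_s ⊔ 𝒳_t` with its integral bound -/

namespace MetricFlow

variable {I : Set ℝ} {𝒳 : MetricFlow.{u} I} {H : ℝ}

/-- **The explicit `Ψ(H, V, η)` of (4.8)**: `√(Hη) + 3η + 2(√η(√(V + Hη) + √V) + 3η²)`
(`lintegral_lintegral_edist_inl_inr_le_ofReal`). [cite: Bamler2023, §4.2, Proposition (closeness of nearby time-slices), (4.8)] -/
def sliceUnionBound (H V η : ℝ) : ℝ :=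
  Real.sqrt (H * η) + 3 * η + 2 * (Real.sqrt η * (Real.sqrt (V + H * η) + Real.sqrt V) + 3 * η * η)

/-- `Ψ(H, V, η) ≥ 0` for `η ≥ 0`. [cite: Bamler2023, §4.2, Proposition (closeness of nearby time-slices), (4.8)] -/
theorem sliceUnionBound_nonneg (H V : ℝ) {η : ℝ} (hη : 0 ≤ η) :
    0 ≤ sliceUnionBound H V η := by
  unfold sliceUnionBound
  positivity

/-- `η ↦ Ψ(H, V, η)` is continuous. [folklore] -/
theorem continuous_sliceUnionBound (H V : ℝ) : Continuous fun η ↦ sliceUnionBound H V η := by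
  unfold sliceUnionBound
  fun_prop

/-- `Ψ(H, V, 0) = 0`. [folklore] -/
theorem sliceUnionBound_zero (H V : ℝ) : sliceUnionBound H V 0 = 0 := by
  simp [sliceUnionBound]

/-- **The comparison space `Z̃ = 𝒳_s ⊔ 𝒳_t` of Bamler 2023, §4.2, with its integral bound (4.8),
from quantitative hypotheses** (the step *"by Propositions (mass distribution), (closeness of
nearby time-slices) there are metric spaces `Z̃^i` … with
`∫∫ d^{Z̃^i}(φ̃^i_s(x), φ̃^i_t(x')) dν^i_{x';s}(x) dμ^i_t(x') ≤ Ψ(δ)`"* of the proof of Lemma 7.?):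
for an `H`-concentrated flow, a conjugate heat flow `(μ_t)` over `I'`, times `s ≤ t` and
`u = t + τ` in `I'`, compact `𝒳_s`, and parameters `δ, ζ, τ, V, η` with `0 < δ ≤ η`,
`0 < ζ ≤ η ≤ 1/2`, `ζ ≤ 1`, `8τH ≤ ζ³`, `V > 0`, the constant of §4.2 (b)
`C(H, δ, ζ, β) ≤ η` for `β = Φ(−√(8V/(ζτ)))/2`, and `t − s ≤ δ`, `Var(μ_t), Var(μ_u) ≤ V`,
`∫∫ d_t dμ_t dμ_t ≤ ∫∫ d_s dμ_s dμ_s + δ`: the mass-distribution Proposition at time `t` (future time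
`u`) gives `μ_t({μ_t(D(·, ζ)) < β}) ≤ ζ`, so the good set `W` is nonempty, §4.2 (b) gives (4.9) on
`W` with gap `η`, and (4.8) in `Z̃ := CrossMetricSum` bounds the cross integral by `Ψ(H, V, η)`.
[cite: Bamler2023, §7.2, Lemma 7.? (arXiv v1 Lemma 160), proof; §4.1, Proposition; §4.2, Proposition (b), (4.8)] -/
theorem IsHConcentrated.exists_crossMetricSum_lintegral_le (hH : 𝒳.IsHConcentrated H)
    (hH0 : 0 ≤ H) {I' : Set ℝ} {μ : ∀ t : I, Measure (𝒳.Slice t)}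
    (hμ : 𝒳.IsConjugateHeatFlow I' μ) {s t u : I} [CompactSpace (𝒳.Slice s)] (hs : (s : ℝ) ∈ I')
    (ht : (t : ℝ) ∈ I') (hu : (u : ℝ) ∈ I') (hst : (s : ℝ) ≤ t) {δ ζ τ V η : ℝ} (hδ : 0 < δ)
    (hζ : 0 < ζ) (hζ1 : ζ ≤ 1) (hτ : 0 < τ) (htu : (u : ℝ) = t + τ) (hV : 0 < V)
    (hτH : 8 * (τ * H) ≤ ζ ^ 3) (hη2 : η ≤ 1 / 2) (hδη : δ ≤ η) (hζη : ζ ≤ η)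
    (hC : ((δ / (2 * ζ) + 3 * Real.sqrt (H * (δ / (4 * ζ ^ 2)))) /
        (Phi (-Real.sqrt (8 * V / (ζ * τ))) / 2) ^ 2 + 4) * (2 * ζ) ≤ η)
    (hts : (t : ℝ) - s ≤ δ) (hVar : variance (μ t) (μ t) ≤ ENNReal.ofReal V)
    (hVar' : variance (μ u) (μ u) ≤ ENNReal.ofReal V)
    (hdiff : 𝒳.averageEDist (μ t) ≤ 𝒳.averageEDist (μ s) + ENNReal.ofReal δ) :
    ∃ (W : Set (𝒳.Slice t)) (h : CrossMetricSum.Hyp (𝒳.sliceCost s t) W η),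
      ∫⁻ y, ∫⁻ x, edist (CrossMetricSum.inl h x) (CrossMetricSum.inr h y) ∂(𝒳.condKernel y s)
        ∂(μ t) ≤ ENNReal.ofReal (sliceUnionBound H V η) := by
  haveI := hμ.1 t ht
  set β : ℝ := Phi (-Real.sqrt (8 * V / (ζ * τ))) / 2 with hβ_def
  have hβ : 0 < β := half_pos (Phi_pos _)
  have hηpos : 0 < η := hδ.trans_le hδη
  have hζlt : ζ < 1 := by linarith
  -- §4.1: the thin set at scale `ζ` is small
  have hthin : μ t (thinSet (μ t) ζ (ENNReal.ofReal β)) ≤ ENNReal.ofReal ζ := by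
    have h := hH.measure_thinSet_slice_le hμ ht hu (r := 1) one_pos hτ (by rw [htu]; ring) hV
      (by rwa [one_pow, mul_one]) hζ hζ1 hτH
    rwa [mul_one] at h
  set W : Set (𝒳.Slice t) := goodSet (μ t) ζ β with hW_def
  have hWne : W.Nonempty := goodSet_nonempty hζlt hthin
  -- §4.2 (b): (4.9) on `W` with gap `η`
  have h49 : ∀ w₁ ∈ W, ∀ w₂ ∈ W, edist w₁ w₂ ≤
      wassersteinW1 (𝒳.condKernel w₁ s) (𝒳.condKernel w₂ s) + ENNReal.ofReal η := by
    intro w₁ hw₁ w₂ hw₂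
    exact (hH.edist_le_wassersteinW1_add_of_mem_goodSet hH0 hμ hs ht hst hδ hζ hβ hts hVar hdiff
      hw₁ hw₂).trans (add_le_add le_rfl (ENNReal.ofReal_le_ofReal hC))
  -- (4.10): the mass off `W^η`
  have hWη : μ t (thickening η W)ᶜ ≤ ENNReal.ofReal η :=
    calc μ t (thickening η W)ᶜ ≤ μ t Wᶜ :=
          measure_mono (compl_subset_compl.2 (self_subset_thickening hηpos W))
      _ ≤ ENNReal.ofReal ζ := measure_compl_goodSet_le hthin
      _ ≤ ENNReal.ofReal η := ENNReal.ofReal_le_ofReal hζη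
  exact ⟨W, 𝒳.sliceCost_hyp hst hWne hηpos h49,
    hH.lintegral_lintegral_edist_inl_inr_le_ofReal hH0 hμ hs ht hst hWne hηpos hη2 h49
      (hts.trans hδη) hV.le hVar hWη⟩

end MetricFlow

/-! ### Combining embeddings: `A₁ ∪_{B₁} Z₀ ∪_{B₂} A₂` -/

/-- **The data of a common comparison space** for the chain `A₁ ⊇ B₁ ⊆ Z₀ ⊇ B₂ ⊆ A₂` of metric
spaces and isometric embeddings `f₁ : B₁ → A₁`, `g₁ : B₁ → Z₀`, `g₂ : B₂ → Z₀`, `f₂ : B₂ → A₂`: a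
metric space with isometric embeddings of `A₁`, `Z₀`, `A₂` identifying the two copies of `B₁` and
the two copies of `B₂` (Bamler 2023, §2.4, Lemma (combining isometric embeddings), used in the
proof of Lemma 7.? to combine `Z̃¹`, `Z_{t'}`, `Z̃²`).
[cite: Bamler2023, §2.4, Lemma (combining isometric embeddings); §7.2, proof of Lemma 7.? (arXiv v1 Lemma 160)] -/
structure DoubleGlue {A₁ B₁ Z₀ B₂ A₂ : Type u} [MetricSpace A₁] [MetricSpace B₁] [MetricSpace Z₀]
    [MetricSpace B₂] [MetricSpace A₂] (f₁ : B₁ → A₁) (g₁ : B₁ → Z₀) (g₂ : B₂ → Z₀)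
    (f₂ : B₂ → A₂) : Type (u + 1) where
  /-- The common comparison space. -/
  carrier : Type u
  /-- Its metric. -/
  [metric : MetricSpace carrier]
  /-- The embedding of `A₁`. -/
  ι₁ : A₁ → carrier
  /-- The embedding of `Z₀`. -/
  ι₀ : Z₀ → carrier
  /-- The embedding of `A₂`. -/
  ι₂ : A₂ → carrier
  /-- `ι₁` is an isometric embedding. -/
  isometry_ι₁ : Isometry ι₁
  /-- `ι₀` is an isometric embedding. -/
  isometry_ι₀ : Isometry ι₀
  /-- `ι₂` is an isometric embedding. -/
  isometry_ι₂ : Isometry ι₂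
  /-- The two copies of `B₁` agree. -/
  comm₁ : ∀ b, ι₁ (f₁ b) = ι₀ (g₁ b)
  /-- The two copies of `B₂` agree. -/
  comm₂ : ∀ b, ι₂ (f₂ b) = ι₀ (g₂ b)

attribute [instance] DoubleGlue.metric

/-- **Lemma (combining isometric embeddings) for the chain `A₁ ⊇ B₁ ⊆ Z₀ ⊇ B₂ ⊆ A₂`**: glue `A₁`
and `Z₀` along `B₁` (`Metric.GlueSpace`), then the result and `A₂` along `B₂`.
[cite: Bamler2023, §2.4, Lemma (combining isometric embeddings)] -/
def doubleGlue {A₁ B₁ Z₀ B₂ A₂ : Type u} [MetricSpace A₁] [MetricSpace B₁] [MetricSpace Z₀]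
    [MetricSpace B₂] [MetricSpace A₂] [Nonempty B₁] [Nonempty B₂] {f₁ : B₁ → A₁} {g₁ : B₁ → Z₀}
    {g₂ : B₂ → Z₀} {f₂ : B₂ → A₂} (hf₁ : Isometry f₁) (hg₁ : Isometry g₁) (hg₂ : Isometry g₂)
    (hf₂ : Isometry f₂) : DoubleGlue f₁ g₁ g₂ f₂ :=
  have hr₁ : Isometry (Metric.toGlueR hf₁ hg₁) := Metric.toGlueR_isometry hf₁ hg₁
  { carrier := Metric.GlueSpace (hr₁.comp hg₂) hf₂
    metric := inferInstance
    ι₁ := Metric.toGlueL (hr₁.comp hg₂) hf₂ ∘ Metric.toGlueL hf₁ hg₁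
    ι₀ := Metric.toGlueL (hr₁.comp hg₂) hf₂ ∘ Metric.toGlueR hf₁ hg₁
    ι₂ := Metric.toGlueR (hr₁.comp hg₂) hf₂
    isometry_ι₁ := (Metric.toGlueL_isometry _ _).comp (Metric.toGlueL_isometry hf₁ hg₁)
    isometry_ι₀ := (Metric.toGlueL_isometry _ _).comp hr₁
    isometry_ι₂ := Metric.toGlueR_isometry _ _
    comm₁ := fun b ↦ congrArg (Metric.toGlueL (hr₁.comp hg₂) hf₂)
      (congrFun (Metric.toGlue_commute hf₁ hg₁) b)
    comm₂ := fun b ↦ (congrFun (Metric.toGlue_commute (hr₁.comp hg₂) hf₂) b).symm }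

/-! ### The comparison spaces of the extended correspondence -/

namespace MetricFlowPair

open MetricFlow

variable {J₁ J₂ : Set ℝ} {P₁ : MetricFlowPair.{u} J₁} {P₂ : MetricFlowPair.{u} J₂} {I₀ : Set ℝ}
  {ℭ₀ : Correspondence₂ P₁.flow P₂.flow I₀} {Ψ : ℝ}

/-- A time-slice of a metric flow pair is nonempty (it carries the probability measure `μ_t`).
[cite: Bamler2023, §5.1, Definition (metric flow pairs and isometries)] -/
theorem nonempty_slice (P : MetricFlowPair.{u} J₁) (t : P.I') : Nonempty (P.flow.Slice t) := by
  haveI := P.isProbabilityMeasure_μ t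
  by_contra hX
  rw [not_nonempty_iff] at hX
  have h1 : P.μ t univ = 1 := measure_univ
  rw [univ_eq_empty_iff.2 hX, measure_empty] at h1
  exact zero_ne_one h1

variable (P₁ P₂ ℭ₀ Ψ) in
/-- **The comparison space `Z_s` of the extended correspondence at a time `s` with near-future time
`s' ∈ I₀`** (Bamler 2023, proof of Lemma 7.?: `Z_s ⊇ Z_{s'}` receiving `𝒳¹_s`, `𝒳²_s` and, through
`Z_{s'}`, `𝒳¹_{s'}`, `𝒳²_{s'}`), bundled with what the final estimate uses: isometric embeddings
`φ₁, φ₂` of `𝒳¹_s, 𝒳²_s` and `ψ₁, ψ₂` of `𝒳¹_{s'}, 𝒳²_{s'}` with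
`d_{Z_s}(ψ₁ x, ψ₂ y) ≤ d_{Z_{s'}}(φ¹_{s'} x, φ²_{s'} y)` and the two bounds (7.14')
`∫∫ d_{Z_s}(φᵢ x, ψᵢ x') dν^i_{x';s}(x) dμ^i_{s'}(x') ≤ Ψ`.
[cite: Bamler2023, §7.2, Lemma 7.? (arXiv v1 Lemma 160), proof] -/
structure ExtensionData (s s' : ℝ) (hs₁ : s ∈ P₁.I') (hs₂ : s ∈ P₂.I') (hs'₁ : s' ∈ ℭ₀.dom₁)
    (hs'₂ : s' ∈ ℭ₀.dom₂) : Type (u + 1) where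
  /-- The comparison space `Z_s`. -/
  Z : Type u
  /-- Its metric, -/
  [instMetricSpace : MetricSpace Z]
  /-- σ-algebra -/
  [instMeasurableSpace : MeasurableSpace Z]
  /-- (the Borel one). -/
  [instBorelSpace : BorelSpace Z]
  /-- `φ¹_s`. -/
  φ₁ : P₁.flow.Slice ⟨s, hs₁⟩ → Z
  /-- `φ²_s`. -/
  φ₂ : P₂.flow.Slice ⟨s, hs₂⟩ → Z
  /-- `φ¹_{s'}` followed by `Z_{s'} ⊆ Z_s`. -/
  ψ₁ : P₁.flow.Slice ⟨s', (ℭ₀.dom₁_subset hs'₁).1⟩ → Z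
  /-- `φ²_{s'}` followed by `Z_{s'} ⊆ Z_s`. -/
  ψ₂ : P₂.flow.Slice ⟨s', (ℭ₀.dom₂_subset hs'₂).1⟩ → Z
  /-- `φ¹_s` is an isometric embedding. -/
  isometry_φ₁ : Isometry φ₁
  /-- `φ²_s` is an isometric embedding. -/
  isometry_φ₂ : Isometry φ₂
  /-- `ψ₁` is an isometric embedding. -/
  isometry_ψ₁ : Isometry ψ₁
  /-- `ψ₂` is an isometric embedding. -/
  isometry_ψ₂ : Isometry ψ₂
  /-- `Z_{s'} ⊆ Z_s` isometrically. -/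
  edist_ψ_le : ∀ x y, edist (ψ₁ x) (ψ₂ y) ≤ edist (ℭ₀.φ₁ s' hs'₁ x) (ℭ₀.φ₂ s' hs'₂ y)
  /-- (7.14') for `i = 1`. -/
  bound₁ : ∫⁻ x', ∫⁻ x, edist (φ₁ x) (ψ₁ x') ∂(P₁.flow.condKernel x' ⟨s, hs₁⟩)
    ∂(P₁.μ ⟨s', (ℭ₀.dom₁_subset hs'₁).1⟩) ≤ ENNReal.ofReal Ψ
  /-- (7.14') for `i = 2`. -/
  bound₂ : ∫⁻ x', ∫⁻ x, edist (φ₂ x) (ψ₂ x') ∂(P₂.flow.condKernel x' ⟨s, hs₂⟩)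
    ∂(P₂.μ ⟨s', (ℭ₀.dom₂_subset hs'₂).1⟩) ≤ ENNReal.ofReal Ψ

attribute [instance] ExtensionData.instMetricSpace ExtensionData.instMeasurableSpace
  ExtensionData.instBorelSpace

/-- **`Z_s := Z_{s'}` when `s' = s`** (the case `s ∈ I₀` of the proof of Lemma 7.?: *"otherwise
choose `s' := s`"*): all four embeddings are those of `ℭ₀`, and the bounds (7.14') vanish since
`ν_{x';s} = δ_{x'}`. [cite: Bamler2023, §7.2, Lemma 7.? (arXiv v1 Lemma 160), proof] -/
def ExtensionData.base {s s' : ℝ} (hs₁ : s ∈ P₁.I') (hs₂ : s ∈ P₂.I')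
    (hs'₁ : s' ∈ ℭ₀.dom₁) (hs'₂ : s' ∈ ℭ₀.dom₂) (e : s' = s) :
    ExtensionData P₁ P₂ ℭ₀ Ψ s s' hs₁ hs₂ hs'₁ hs'₂ := by
  subst e
  exact
    { Z := ℭ₀.Z ⟨s', (ℭ₀.dom₁_subset hs'₁).2⟩
      φ₁ := ℭ₀.φ₁ s' hs'₁
      φ₂ := ℭ₀.φ₂ s' hs'₂
      ψ₁ := ℭ₀.φ₁ s' hs'₁
      ψ₂ := ℭ₀.φ₂ s' hs'₂
      isometry_φ₁ := ℭ₀.isometry₁ s' hs'₁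
      isometry_φ₂ := ℭ₀.isometry₂ s' hs'₂
      isometry_ψ₁ := ℭ₀.isometry₁ s' hs'₁
      isometry_ψ₂ := ℭ₀.isometry₂ s' hs'₂
      edist_ψ_le := fun _ _ ↦ le_rfl
      bound₁ := by
        have h0 : ∀ x', ∫⁻ x, edist (ℭ₀.φ₁ s' hs'₁ x) (ℭ₀.φ₁ s' hs'₁ x')
            ∂(P₁.flow.condKernel x' ⟨s', hs₁⟩) = 0 := fun x' ↦ by
          rw [P₁.flow.condKernel_self, lintegral_dirac, edist_self]
        simp only [h0, lintegral_zero]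
        exact bot_le
      bound₂ := by
        have h0 : ∀ x', ∫⁻ x, edist (ℭ₀.φ₂ s' hs'₂ x) (ℭ₀.φ₂ s' hs'₂ x')
            ∂(P₂.flow.condKernel x' ⟨s', hs₂⟩) = 0 := fun x' ↦ by
          rw [P₂.flow.condKernel_self, lintegral_dirac, edist_self]
        simp only [h0, lintegral_zero]
        exact bot_le }

/-- **`Z_s := Z̃¹ ∪_{𝒳¹_{s'}} Z_{s'} ∪_{𝒳²_{s'}} Z̃²`** (the case `s ∉ I₀` of the proof of Lemma 7.?), from
the two spaces `Z̃^i = 𝒳^i_s ⊔ 𝒳^i_{s'}` (`CrossMetricSum` for data `Wᵢ`, gap `η`) with their bounds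
(7.14'): the embeddings are `φᵢ := ιᵢ ∘ inl`, `ψᵢ := ι₀ ∘ φ^i_{s'}` (`= ιᵢ ∘ inr` by the gluing
identifications), so the bounds transfer and `d_{Z_s}(ψ₁ x, ψ₂ y) = d_{Z_{s'}}(φ¹_{s'} x, φ²_{s'} y)`.
[cite: Bamler2023, §7.2, Lemma 7.? (arXiv v1 Lemma 160), proof; §2.4, Lemma (combining isometric embeddings)] -/
def ExtensionData.ofSliceUnion {s s' : ℝ} (hs₁ : s ∈ P₁.I') (hs₂ : s ∈ P₂.I')
    (hs'₁ : s' ∈ ℭ₀.dom₁) (hs'₂ : s' ∈ ℭ₀.dom₂) {η : ℝ}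
    (W₁ : Set (P₁.flow.Slice ⟨s', (ℭ₀.dom₁_subset hs'₁).1⟩))
    (h₁ : CrossMetricSum.Hyp (P₁.flow.sliceCost ⟨s, hs₁⟩ ⟨s', (ℭ₀.dom₁_subset hs'₁).1⟩) W₁ η)
    (hb₁ : ∫⁻ x', ∫⁻ x, edist (CrossMetricSum.inl h₁ x) (CrossMetricSum.inr h₁ x')
      ∂(P₁.flow.condKernel x' ⟨s, hs₁⟩) ∂(P₁.μ ⟨s', (ℭ₀.dom₁_subset hs'₁).1⟩) ≤ ENNReal.ofReal Ψ)
    (W₂ : Set (P₂.flow.Slice ⟨s', (ℭ₀.dom₂_subset hs'₂).1⟩))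
    (h₂ : CrossMetricSum.Hyp (P₂.flow.sliceCost ⟨s, hs₂⟩ ⟨s', (ℭ₀.dom₂_subset hs'₂).1⟩) W₂ η)
    (hb₂ : ∫⁻ x', ∫⁻ x, edist (CrossMetricSum.inl h₂ x) (CrossMetricSum.inr h₂ x')
      ∂(P₂.flow.condKernel x' ⟨s, hs₂⟩) ∂(P₂.μ ⟨s', (ℭ₀.dom₂_subset hs'₂).1⟩) ≤ ENNReal.ofReal Ψ) :
    ExtensionData P₁ P₂ ℭ₀ Ψ s s' hs₁ hs₂ hs'₁ hs'₂ :=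
  haveI := P₁.nonempty_slice ⟨s', (ℭ₀.dom₁_subset hs'₁).1⟩
  haveI := P₂.nonempty_slice ⟨s', (ℭ₀.dom₂_subset hs'₂).1⟩
  let G := doubleGlue (CrossMetricSum.isometry_inr h₁) (ℭ₀.isometry₁ s' hs'₁) (ℭ₀.isometry₂ s' hs'₂)
    (CrossMetricSum.isometry_inr h₂)
  { Z := G.carrier
    instMetricSpace := G.metric
    instMeasurableSpace := borel G.carrier
    instBorelSpace := @BorelSpace.mk _ _ (borel G.carrier) rfl
    φ₁ := G.ι₁ ∘ CrossMetricSum.inl h₁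
    φ₂ := G.ι₂ ∘ CrossMetricSum.inl h₂
    ψ₁ := G.ι₀ ∘ ℭ₀.φ₁ s' hs'₁
    ψ₂ := G.ι₀ ∘ ℭ₀.φ₂ s' hs'₂
    isometry_φ₁ := G.isometry_ι₁.comp (CrossMetricSum.isometry_inl h₁)
    isometry_φ₂ := G.isometry_ι₂.comp (CrossMetricSum.isometry_inl h₂)
    isometry_ψ₁ := G.isometry_ι₀.comp (ℭ₀.isometry₁ s' hs'₁)
    isometry_ψ₂ := G.isometry_ι₀.comp (ℭ₀.isometry₂ s' hs'₂)
    edist_ψ_le := fun x y ↦ (G.isometry_ι₀.edist_eq _ _).le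
    bound₁ := by
      have he : ∀ x x', edist ((G.ι₁ ∘ CrossMetricSum.inl h₁) x) ((G.ι₀ ∘ ℭ₀.φ₁ s' hs'₁) x') =
          edist (CrossMetricSum.inl h₁ x) (CrossMetricSum.inr h₁ x') := fun x x' ↦ by
        rw [comp_apply, comp_apply, ← G.comm₁, G.isometry_ι₁.edist_eq]
      simp only [he]
      exact hb₁
    bound₂ := by
      have he : ∀ x x', edist ((G.ι₂ ∘ CrossMetricSum.inl h₂) x) ((G.ι₀ ∘ ℭ₀.φ₂ s' hs'₂) x') =
          edist (CrossMetricSum.inl h₂ x) (CrossMetricSum.inr h₂ x') := fun x x' ↦ by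
        rw [comp_apply, comp_apply, ← G.comm₂, G.isometry_ι₂.edist_eq]
      simp only [he]
      exact hb₂ }

/-- `ExtensionData.ofSliceUnion` applied to the data provided by existence statements (as produced
by `IsHConcentrated.exists_crossMetricSum_lintegral_le`), through the axiom of choice.
[cite: Bamler2023, §7.2, Lemma 7.? (arXiv v1 Lemma 160), proof] -/
def ExtensionData.ofExists {s s' : ℝ} (hs₁ : s ∈ P₁.I') (hs₂ : s ∈ P₂.I') (hs'₁ : s' ∈ ℭ₀.dom₁)
    (hs'₂ : s' ∈ ℭ₀.dom₂) {η : ℝ}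
    (hex₁ : ∃ (W₁ : Set (P₁.flow.Slice ⟨s', (ℭ₀.dom₁_subset hs'₁).1⟩))
      (h₁ : CrossMetricSum.Hyp (P₁.flow.sliceCost ⟨s, hs₁⟩ ⟨s', (ℭ₀.dom₁_subset hs'₁).1⟩) W₁ η),
      ∫⁻ x', ∫⁻ x, edist (CrossMetricSum.inl h₁ x) (CrossMetricSum.inr h₁ x')
        ∂(P₁.flow.condKernel x' ⟨s, hs₁⟩) ∂(P₁.μ ⟨s', (ℭ₀.dom₁_subset hs'₁).1⟩) ≤ ENNReal.ofReal Ψ)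
    (hex₂ : ∃ (W₂ : Set (P₂.flow.Slice ⟨s', (ℭ₀.dom₂_subset hs'₂).1⟩))
      (h₂ : CrossMetricSum.Hyp (P₂.flow.sliceCost ⟨s, hs₂⟩ ⟨s', (ℭ₀.dom₂_subset hs'₂).1⟩) W₂ η),
      ∫⁻ x', ∫⁻ x, edist (CrossMetricSum.inl h₂ x) (CrossMetricSum.inr h₂ x')
        ∂(P₂.flow.condKernel x' ⟨s, hs₂⟩) ∂(P₂.μ ⟨s', (ℭ₀.dom₂_subset hs'₂).1⟩) ≤ ENNReal.ofReal Ψ) :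
    ExtensionData P₁ P₂ ℭ₀ Ψ s s' hs₁ hs₂ hs'₁ hs'₂ :=
  ExtensionData.ofSliceUnion hs₁ hs₂ hs'₁ hs'₂ hex₁.choose hex₁.choose_spec.choose
    hex₁.choose_spec.choose_spec hex₂.choose hex₂.choose_spec.choose hex₂.choose_spec.choose_spec

/-! ### The extended correspondence -/

variable (P₁ P₂ ℭ₀ Ψ) in
/-- **The extended correspondence `ℭ₁` over `I₁`** (Bamler 2023, proof of Lemma 7.?: *"we can
construct objects `(Z_t, d^Z_t)`, `(φ^i_t)_{i=1,2}`, `q_t`, which allow us to extend `ℭ₀` to a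
correspondence `ℭ₁` between `𝒳¹, 𝒳²` that is defined over `I₁`"*): comparison spaces `Z_t`, `t ∈ I₁`,
and embeddings `φ^i_t` taken from extension data `D t` at every `t ∈ I₁` (near-future times
`σ t ∈ I₀`), both domains equal to `I₁`. [cite: Bamler2023, §7.2, Lemma 7.? (arXiv v1 Lemma 160), proof] -/
def extCorrespondence {I₁ : Set ℝ} (hI₁₁ : I₁ ⊆ P₁.I') (hI₁₂ : I₁ ⊆ P₂.I') (σ : ∀ t, t ∈ I₁ → ℝ)
    (hσ₁ : ∀ t (ht : t ∈ I₁), σ t ht ∈ ℭ₀.dom₁) (hσ₂ : ∀ t (ht : t ∈ I₁), σ t ht ∈ ℭ₀.dom₂)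
    (D : ∀ t (ht : t ∈ I₁),
      ExtensionData P₁ P₂ ℭ₀ Ψ t (σ t ht) (hI₁₁ ht) (hI₁₂ ht) (hσ₁ t ht) (hσ₂ t ht)) :
    Correspondence₂ P₁.flow P₂.flow I₁ where
  Z t := (D t t.2).Z
  instMetricSpace t := (D t t.2).instMetricSpace
  instMeasurableSpace t := (D t t.2).instMeasurableSpace
  instBorelSpace t := (D t t.2).instBorelSpace
  dom₁ := I₁
  dom₂ := I₁
  dom₁_subset := fun _ ht ↦ ⟨hI₁₁ ht, ht⟩
  dom₂_subset := fun _ ht ↦ ⟨hI₁₂ ht, ht⟩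
  φ₁ t ht := (D t ht).φ₁
  φ₂ t ht := (D t ht).φ₂
  isometry₁ t ht := (D t ht).isometry_φ₁
  isometry₂ t ht := (D t ht).isometry_φ₂

/-- The integrand of `d_𝔽^{ℭ₁, ·}` at `(s, t)` is `d_{W₁}^{Z_s}((φ₁)_* ν¹_{x¹;s}, (φ₂)_* ν²_{x²;s})` with the
embeddings of the extension data at `s` (by `rfl`). [cite: Bamler2023, §7.2, Lemma 7.? (arXiv v1 Lemma 160), proof] -/
theorem kernelDistWithin_extCorrespondence {I₁ : Set ℝ} (hI₁₁ : I₁ ⊆ P₁.I') (hI₁₂ : I₁ ⊆ P₂.I')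
    (σ : ∀ t, t ∈ I₁ → ℝ) (hσ₁ : ∀ t (ht : t ∈ I₁), σ t ht ∈ ℭ₀.dom₁)
    (hσ₂ : ∀ t (ht : t ∈ I₁), σ t ht ∈ ℭ₀.dom₂)
    (D : ∀ t (ht : t ∈ I₁),
      ExtensionData P₁ P₂ ℭ₀ Ψ t (σ t ht) (hI₁₁ ht) (hI₁₂ ht) (hσ₁ t ht) (hσ₂ t ht))
    {s t : ℝ} (hs : s ∈ I₁) (ht : t ∈ I₁)
    (p : P₁.flow.Slice ⟨t, hI₁₁ ht⟩ × P₂.flow.Slice ⟨t, hI₁₂ ht⟩) :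
    kernelDistWithin P₁ P₂ (extCorrespondence P₁ P₂ ℭ₀ Ψ hI₁₁ hI₁₂ σ hσ₁ hσ₂ D) hs hs ht ht p =
      wassersteinW1 ((P₁.flow.condKernel p.1 ⟨s, hI₁₁ hs⟩).map (D s hs).φ₁)
        ((P₂.flow.condKernel p.2 ⟨s, hI₁₂ hs⟩).map (D s hs).φ₂) := rfl

end MetricFlowPair

end Literature.Geometry.Riemannian

end
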